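import Summits.QuantumAdvantage.QuantumAdvantage.Theorems.LinnikCubicClassGroupsDegreeOnePrimesEscapeOdlyzkoDiscriminantBound
import Summits.QuantumAdvantage.QuantumAdvantage.Theorems.LinnikCubicClassGroupsDegreeOnePrimesEscapeRootDiscriminant
import Mathlib.NumberTheory.ZetaValues
import HarnessLib

/-!
# Odlyzko's discriminant bound, numeric form: the gains and the optimisation in `σ`

Topic `Summits/QuantumAdvantage/QuantumAdvantage/Theorems`, helper file for the crux
`DegreeOnePrimesEscape` (stmt-QuantumAdvantage-11543, closed) of route `LinnikCubicClassGroups`;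
cell B2b-1 (linnik-cubic), PART A. HONEST FRAMING: the value of this file is a THEOREM (explicit,
kernel-checked discriminant bounds) — NOT summit progress.

Companion of `…OdlyzkoDiscriminantBound` (`OdlyzkoBound.log_absdiscr_ge_odlyzko`: Stark's bound
improved by Odlyzko's differencing method with one difference, gains
`g_ℝ = (25/2)(ψ(16/25) − ψ(31/50))`, `g_ℂ = (25/2)(ψ(32/25) − ψ(31/25))` per real place / complex
pair).  Here the gains are evaluated and the bound is optimised in `σ`:

* `re_digamma_sub_ge` — for real `0 < x₀ ≤ x` and every `N`:
  `ψ(x) − ψ(x₀) ≥ (x − x₀)(Σ_{k<N} 1/((x₀+k)(x+k)) + 1/(x+N))` (series `ψ(x) − ψ(x₀) =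
  Σ_k (x−x₀)/((x₀+k)(x+k))`, tail `≥` the telescoping `Σ_{k≥N} (1/(x+k) − 1/(x+k+1)) = 1/(x+N)`);
* `gain_real_ge`, `gain_complex_ge` — `g_ℝ ≥ 0.838`, `g_ℂ ≥ 0.59`;
* `log_absdiscr_ge_odlyzko_linear` — tangent-line form at `σ = 1 + h`, `0 < h ≤ 1/20`:
  `log|d_K| ≥ r₁(log 4π + γ + 0.838 − (π²/4)h) + 2r₂(log 2π + γ + 0.59 − (π²/6)h) − 2/h − 2/(1+h) − 323125/20832`;
* `log_absdiscr_ge_odlyzko_signature` — **for EVERY number field `K` of degree `n = r₁ + 2r₂`: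
  `log|d_K| ≥ r₁(log 4π + γ + 0.838) + 2r₂(log 2π + γ + 0.59) − 2√(π²n/2) − 60`**;
  exponentiated: `absdiscr_ge_odlyzko_signature`;
* the numerics `51.7 < 4πe^{γ+0.838}`, `20.18 < 2πe^{γ+0.59}`, the asymptotic root-discriminant
  corollaries and the degree bound are in the companion file `…OdlyzkoRootDiscriminant`.

## References

* A. M. Odlyzko, *Lower bounds for discriminants of number fields. II*, Tôhoku Math. J. 29 (1977)
  209–216. [Odlyzko1977]
* A. M. Odlyzko, *Lower bounds for discriminants of number fields*, Acta Arith. 29 (1976) 275–297.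
  [Odlyzko1976]
-/

noncomputable section

open scoped NumberField
open Complex Filter Topology Set NumberField NumberField.InfinitePlace

namespace Summit.QuantumAdvantage.QuantumAdvantage.Theorems.DegreeOnePrimesEscape

namespace OdlyzkoBound

open Literature.NumberTheory.LFunctions Literature.NumberTheory.LFunctions.NumberField

/-! ### A lower bound for differences of the digamma function on the real axis -/

/-- The telescoping series `Σ_k (1/(c+k) − 1/(c+k+1)) = 1/c` for `c > 0`. [folklore] -/
private theorem hasSum_inv_sub_inv_succ {c : ℝ} (hc : 0 < c) :
    HasSum (fun k : ℕ ↦ 1 / (c + k) - 1 / (c + k + 1)) (1 / c) := by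
  have hnn : ∀ k : ℕ, 0 ≤ 1 / (c + k) - 1 / (c + k + 1) := fun k ↦ by
    rw [sub_nonneg]
    exact one_div_le_one_div_of_le (by positivity) (by linarith)
  refine (hasSum_iff_tendsto_nat_of_nonneg hnn _).2 ?_
  have hpartial : ∀ n : ℕ, ∑ k ∈ Finset.range n, (1 / (c + k) - 1 / (c + k + 1)) =
      1 / c - 1 / (c + n) := by
    intro n
    induction n with
    | zero => simp
    | succ n ih =>
      rw [Finset.sum_range_succ, ih]
      push_cast
      ring
  simp_rw [hpartial]
  have h0 : Tendsto (fun n : ℕ ↦ 1 / (c + (n : ℝ))) atTop (𝓝 0) :=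
    tendsto_const_nhds.div_atTop (tendsto_atTop_add_const_left _ _ tendsto_natCast_atTop_atTop)
  simpa using tendsto_const_nhds.sub h0

/-- **Lower bound for `ψ(x) − ψ(x₀)` on the real axis**: for `0 < x₀ ≤ x` and every `N`,
`(x − x₀)(Σ_{k<N} 1/((x₀+k)(x+k)) + 1/(x+N)) ≤ ψ(x) − ψ(x₀)`
(from `ψ(x) − ψ(x₀) = Σ_k (x−x₀)/((x₀+k)(x+k))`, [AndrewsAskeyRoy1999, (1.2.13)]; the tail is bounded
below by the telescoping series `(x−x₀) Σ_{k≥N} (1/(x+k) − 1/(x+k+1)) = (x−x₀)/(x+N)` because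
`x₀ + k ≤ x + k + 1`). [cite: AndrewsAskeyRoy1999, Thm 1.2.5 (1.2.13)] -/
theorem re_digamma_sub_ge {x₀ x : ℝ} (hx₀ : 0 < x₀) (hx : x₀ ≤ x) (N : ℕ) :
    (x - x₀) * (∑ k ∈ Finset.range N, 1 / ((x₀ + k) * (x + k)) + 1 / (x + N)) ≤
      (digamma (x : ℂ)).re - (digamma (x₀ : ℂ)).re := by
  have hxpos : 0 < x := lt_of_lt_of_le hx₀ hx
  have h₀ := hasSum_re_digamma_ofReal hx₀
  have h₁ := hasSum_re_digamma_ofReal hxpos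
  set f : ℕ → ℝ := fun k ↦ 1 / (x₀ + k) - 1 / (x + k) with hf
  have hdiff : HasSum f ((digamma (x : ℂ)).re + Real.eulerMascheroniConstant -
      ((digamma (x₀ : ℂ)).re + Real.eulerMascheroniConstant)) := by
    refine (h₁.sub h₀).congr_fun fun k ↦ ?_
    simp only [hf]
    ring
  have hfsum : Summable f := hdiff.summable
  -- finite part
  have hfin : ∑ k ∈ Finset.range N, f k =
      (x - x₀) * ∑ k ∈ Finset.range N, 1 / ((x₀ + k) * (x + k)) := by
    rw [Finset.mul_sum]
    refine Finset.sum_congr rfl fun k _ ↦ ?_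
    have ha : (0 : ℝ) < x₀ + k := by positivity
    have hb : (0 : ℝ) < x + k := by positivity
    simp only [hf]
    field_simp
    ring
  -- tail
  have htele := hasSum_inv_sub_inv_succ (c := x + N) (by positivity)
  have htail_le : ∀ k : ℕ, (x - x₀) * (1 / (x + N + k) - 1 / (x + N + k + 1)) ≤ f (k + N) := by
    intro k
    have ha : (0 : ℝ) < x₀ + (k + N : ℕ) := by positivity
    have hb : (0 : ℝ) < x + (k + N : ℕ) := by positivity
    have hc : (0 : ℝ) < x + N + k := by positivity
    have hd : (0 : ℝ) < x + N + k + 1 := by positivity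
    have e1 : f (k + N) = (x - x₀) / ((x₀ + (k + N : ℕ)) * (x + (k + N : ℕ))) := by
      simp only [hf]
      field_simp
      ring
    have e2 : (x - x₀) * (1 / (x + N + k) - 1 / (x + N + k + 1)) =
        (x - x₀) / ((x + N + k) * (x + N + k + 1)) := by
      field_simp
      ring
    rw [e1, e2]
    refine div_le_div_of_nonneg_left (by linarith) (mul_pos ha hb) ?_
    have h1 : x₀ + (k + N : ℕ) ≤ x + N + k + 1 := by push_cast; linarith
    have h2 : x + (k + N : ℕ) = x + N + k := by push_cast; ring
    rw [h2, mul_comm (x + N + k)]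
    exact mul_le_mul_of_nonneg_right h1 hc.le
  have htail : (x - x₀) * (1 / (x + N)) ≤ ∑' k, f (k + N) :=
    hasSum_le htail_le (htele.mul_left _) ((summable_nat_add_iff N).2 hfsum).hasSum
  have hsplit := hfsum.sum_add_tsum_nat_add N
  rw [hdiff.tsum_eq] at hsplit
  rw [mul_add, ← hfin]
  linarith

/-! ### Numerics for the gains -/

/-- **`g_ℝ = (25/2)(ψ(16/25) − ψ(31/50)) ≥ 0.838`** (ten terms and the telescoping tail;
true value `0.8395…`). [folklore] -/
theorem gain_real_ge :
    (0.838 : ℝ) ≤ 25 / 2 * ((digamma ((16 / 25 : ℝ) : ℂ)).re - (digamma ((31 / 50 : ℝ) : ℂ)).re) := by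
  have h := re_digamma_sub_ge (x₀ := 31 / 50) (x := 16 / 25) (by norm_num) (by norm_num) 10
  have hS : (0.838 : ℝ) ≤ 25 / 2 * ((16 / 25 - 31 / 50 : ℝ) *
      (∑ k ∈ Finset.range 10, 1 / ((31 / 50 + (k : ℝ)) * (16 / 25 + (k : ℝ))) +
        1 / (16 / 25 + ((10 : ℕ) : ℝ)))) := by
    simp only [Finset.sum_range_succ, Finset.sum_range_zero]
    norm_num
  linarith

/-- **`g_ℂ = (25/2)(ψ(32/25) − ψ(31/25)) ≥ 0.59`** (ten terms and the telescoping tail;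
true value `0.5921…`). [folklore] -/
theorem gain_complex_ge :
    (0.59 : ℝ) ≤ 25 / 2 * ((digamma ((32 / 25 : ℝ) : ℂ)).re - (digamma ((31 / 25 : ℝ) : ℂ)).re) := by
  have h := re_digamma_sub_ge (x₀ := 31 / 25) (x := 32 / 25) (by norm_num) (by norm_num) 10
  have hS : (0.59 : ℝ) ≤ 25 / 2 * ((32 / 25 - 31 / 25 : ℝ) *
      (∑ k ∈ Finset.range 10, 1 / ((31 / 25 + (k : ℝ)) * (32 / 25 + (k : ℝ))) +
        1 / (32 / 25 + ((10 : ℕ) : ℝ)))) := by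
    simp only [Finset.sum_range_succ, Finset.sum_range_zero]
    norm_num
  linarith

/-! ### Tangent-line inputs for `ψ` at `1/2` and `1` -/

/-- `Σ_{k ≥ 0} (k+1)^{−2} = π²/6`. [folklore] -/
private theorem hasSum_inv_nat_add_one_sq :
    HasSum (fun k : ℕ ↦ 1 / ((k : ℝ) + 1) ^ 2) (Real.pi ^ 2 / 6) := by
  have h := (hasSum_nat_add_iff' (f := fun n : ℕ ↦ (1 : ℝ) / (n : ℝ) ^ 2) 1).mpr hasSum_zeta_two
  simp only [Finset.sum_range_one, Nat.cast_zero, ne_eq, OfNat.ofNat_ne_zero, not_false_eq_true,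
    zero_pow, div_zero, sub_zero, Nat.cast_add, Nat.cast_one] at h
  exact h

/-- `Σ_{k ≥ 0} (k+½)^{−2} = π²/2` (odd part of `ζ(2)`, times `4`). [folklore] -/
private theorem hasSum_inv_nat_add_half_sq :
    HasSum (fun k : ℕ ↦ 1 / ((k : ℝ) + 1 / 2) ^ 2) (Real.pi ^ 2 / 2) := by
  set f : ℕ → ℝ := fun n ↦ 1 / (n : ℝ) ^ 2 with hf
  have h : HasSum f (Real.pi ^ 2 / 6) := hasSum_zeta_two
  have he : HasSum (fun k : ℕ ↦ f (2 * k)) (Real.pi ^ 2 / 24) := by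
    rw [show Real.pi ^ 2 / 24 = 1 / 4 * (Real.pi ^ 2 / 6) by ring]
    exact (h.mul_left (1 / 4)).congr_fun fun k ↦ by simp only [hf]; push_cast; ring
  have hinj : Function.Injective (fun k : ℕ ↦ 2 * k + 1) := fun a b hab ↦ by simpa using hab
  obtain ⟨x, hx⟩ := h.summable.comp_injective hinj
  have hx' : HasSum (fun k : ℕ ↦ f (2 * k + 1)) x := hx
  have htot : HasSum f (Real.pi ^ 2 / 24 + x) := he.even_add_odd hx'
  have hxval : x = Real.pi ^ 2 / 8 := by
    have := htot.unique h
    linarith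
  rw [show Real.pi ^ 2 / 2 = 4 * x by rw [hxval]; ring]
  refine (hx'.mul_left 4).congr_fun fun k ↦ ?_
  simp only [hf]
  have hk : (2 * (k : ℝ) + 1) ≠ 0 := by positivity
  have hk' : ((k : ℝ) + 1 / 2) ≠ 0 := by positivity
  push_cast
  field_simp
  ring

/-- `ψ((1+h)/2) ≤ −γ − 2 log 2 + (π²/4) h` for `h ≥ 0`. [folklore] -/
private theorem re_digamma_half_add_le {h : ℝ} (hh : 0 ≤ h) :
    (digamma ((((1 + h) / 2 : ℝ)) : ℂ)).re ≤
      -Real.eulerMascheroniConstant - 2 * Real.log 2 + Real.pi ^ 2 / 4 * h := by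
  have h1 := re_digamma_ofReal_sub_le (x₀ := 1 / 2) (x := (1 + h) / 2) (by norm_num) (by linarith)
    hasSum_inv_nat_add_half_sq
  have hhalf : (digamma (((1 / 2 : ℝ)) : ℂ)).re = -2 * Real.log 2 - Real.eulerMascheroniConstant := by
    have e : digamma (((1 / 2 : ℝ)) : ℂ) =
        (((-2 * Real.log 2 - Real.eulerMascheroniConstant : ℝ)) : ℂ) := by
      rw [show (((1 / 2 : ℝ)) : ℂ) = 1 / 2 by push_cast; ring, Complex.digamma_one_half]
      push_cast
      simp only [Complex.ofNat_log]
    rw [e, ofReal_re]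
  rw [hhalf] at h1
  nlinarith [Real.pi_pos]

/-- `ψ(1+h) ≤ −γ + (π²/6) h` for `h ≥ 0`. [folklore] -/
private theorem re_digamma_one_add_le {h : ℝ} (hh : 0 ≤ h) :
    (digamma (((1 + h : ℝ)) : ℂ)).re ≤ -Real.eulerMascheroniConstant + Real.pi ^ 2 / 6 * h := by
  have h1 := re_digamma_ofReal_sub_le (x₀ := 1) (x := 1 + h) one_pos (by linarith)
    hasSum_inv_nat_add_one_sq
  have hone : (digamma (((1 : ℝ)) : ℂ)).re = -Real.eulerMascheroniConstant := by
    rw [ofReal_one, Complex.digamma_one]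
    simp
  rw [hone] at h1
  nlinarith [Real.pi_pos]

/-! ### The bound at `σ = 1 + h` and its optimisation -/

variable (K : Type*) [Field K] [NumberField K]

/-- **Tangent-line form of Odlyzko's one-difference bound**: for `0 < h ≤ 1/20`,
`log|d_K| ≥ r₁(log 4π + γ + 0.838 − (π²/4)h) + 2r₂(log 2π + γ + 0.59 − (π²/6)h) − 2/h − 2/(1+h) − 323125/20832`.
[cite: Odlyzko1977, Theorem 1 (method; one-term instance)] -/
theorem log_absdiscr_ge_odlyzko_linear {h : ℝ} (hh : 0 < h) (hh' : h ≤ 1 / 20) :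
    (nrRealPlaces K : ℝ) * (Real.log (4 * Real.pi) + Real.eulerMascheroniConstant + 0.838 -
        Real.pi ^ 2 / 4 * h) +
      2 * (nrComplexPlaces K : ℝ) * (Real.log (2 * Real.pi) + Real.eulerMascheroniConstant + 0.59 -
        Real.pi ^ 2 / 6 * h) -
      2 / h - 2 / (1 + h) - 323125 / 20832 ≤ Real.log ((discr K).natAbs : ℝ) := by
  have hmain := log_absdiscr_ge_odlyzko K (σ := 1 + h) (by linarith) (by linarith)
  have hψ1 := re_digamma_half_add_le hh.le
  have hψ2 := re_digamma_one_add_le hh.le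
  have hgR := gain_real_ge
  have hgC := gain_complex_ge
  have hcast1 : (((1 + h : ℝ)) : ℂ) / 2 = ((((1 + h) / 2 : ℝ)) : ℂ) := by push_cast; ring
  rw [hcast1, show (1 + h - 1 : ℝ) = h by ring] at hmain
  have h4π : Real.log (4 * Real.pi) = 2 * Real.log 2 + Real.log Real.pi := by
    rw [Real.log_mul (by norm_num) Real.pi_ne_zero, show (4 : ℝ) = 2 ^ 2 by norm_num, Real.log_pow]
    push_cast
    ring
  have hr1 : (0 : ℝ) ≤ nrRealPlaces K := Nat.cast_nonneg _
  have hr2 : (0 : ℝ) ≤ nrComplexPlaces K := Nat.cast_nonneg _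
  have e1 := mul_le_mul_of_nonneg_left hψ1 hr1
  have e2 := mul_le_mul_of_nonneg_left hψ2 hr2
  have e3 := mul_le_mul_of_nonneg_left hgR hr1
  have e4 := mul_le_mul_of_nonneg_left hgC hr2
  rw [h4π]
  linarith [e1, e2, e3, e4, hmain]

/-- **Odlyzko's one-difference bound, explicit in the degree**: for EVERY number field `K` of degree
`n = r₁ + 2r₂`, `log|d_K| ≥ r₁(log 4π + γ + 0.838) + 2r₂(log 2π + γ + 0.59) − 2√(π²n/2) − 60`
(for `√(π²n/2) ≥ 40` take `h = 2/√(π²n/2)`; otherwise `h = 1/20`).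
[cite: Odlyzko1977, Theorem 1 (method; one-term instance)] -/
theorem log_absdiscr_ge_odlyzko_signature :
    (nrRealPlaces K : ℝ) * (Real.log (4 * Real.pi) + Real.eulerMascheroniConstant + 0.838) +
        2 * (nrComplexPlaces K : ℝ) * (Real.log (2 * Real.pi) + Real.eulerMascheroniConstant + 0.59) -
        2 * Real.sqrt (Real.pi ^ 2 * Module.finrank ℚ K / 2) - 60 ≤
      Real.log ((discr K).natAbs : ℝ) := by
  set n : ℕ := Module.finrank ℚ K with hn_def
  set s : ℝ := Real.sqrt (Real.pi ^ 2 * n / 2) with hs_def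
  have hπ0 := Real.pi_pos
  have hs2 : s ^ 2 = Real.pi ^ 2 * n / 2 := by rw [hs_def, Real.sq_sqrt (by positivity)]
  have hs0 : 0 < s := by
    rw [hs_def]
    refine Real.sqrt_pos.2 ?_
    have : (1 : ℝ) ≤ n := by rw [hn_def]; exact_mod_cast Module.finrank_pos
    positivity
  have hrank : (nrRealPlaces K : ℝ) + 2 * nrComplexPlaces K = n := by
    rw [hn_def]; exact_mod_cast card_add_two_mul_card_eq_rank K
  have hr1 : (0 : ℝ) ≤ nrRealPlaces K := Nat.cast_nonneg _
  have hr2 : (0 : ℝ) ≤ nrComplexPlaces K := Nat.cast_nonneg _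
  -- the slope terms at step `h` cost at most `n (π²/4) h`
  have hslope : ∀ h : ℝ, 0 ≤ h →
      (nrRealPlaces K : ℝ) * (Real.pi ^ 2 / 4 * h) +
        2 * (nrComplexPlaces K : ℝ) * (Real.pi ^ 2 / 6 * h) ≤ n * (Real.pi ^ 2 / 4 * h) := by
    intro h hh
    rw [← hrank]
    nlinarith [mul_nonneg hr2 (mul_nonneg (sq_nonneg Real.pi) hh)]
  rcases le_or_gt 40 s with hs40 | hs40
  · -- `h = 2/s ≤ 1/20`
    have hh : 0 < 2 / s := by positivity
    have hh' : 2 / s ≤ 1 / 20 := by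
      rw [div_le_div_iff₀ hs0 (by norm_num)]; linarith
    have hmain := log_absdiscr_ge_odlyzko_linear K hh hh'
    have ht1 : (n : ℝ) * (Real.pi ^ 2 / 4 * (2 / s)) = s := by
      calc (n : ℝ) * (Real.pi ^ 2 / 4 * (2 / s)) = (Real.pi ^ 2 * n / 2) / s := by ring
        _ = s ^ 2 / s := by rw [← hs2]
        _ = s := by rw [sq, mul_div_cancel_right₀ _ hs0.ne']
    have ht2 : 2 / (2 / s) = s := by field_simp
    have ht3 : 2 / (1 + 2 / s) ≤ 2 := by
      rw [div_le_iff₀ (by positivity)]; nlinarith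
    rw [ht2] at hmain
    have hsl := hslope (2 / s) hh.le
    linarith [hmain, hsl, ht1, ht3]
  · -- `h = 1/20`; here `s < 40`, so the slope cost `n π²/80 = s²/40 ≤ 2 s`
    have hmain := log_absdiscr_ge_odlyzko_linear K (h := 1 / 20) (by norm_num) le_rfl
    have hsl := hslope (1 / 20) (by norm_num)
    have ht1 : (n : ℝ) * (Real.pi ^ 2 / 4 * (1 / 20)) = s ^ 2 / 40 := by rw [hs2]; ring
    have hsq : s ^ 2 / 40 ≤ 2 * s := by
      rw [div_le_iff₀ (by norm_num)]; nlinarith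
    have e5 : (2 : ℝ) / (1 / 20) = 40 := by norm_num
    have e6 : (2 : ℝ) / (1 + 1 / 20) = 40 / 21 := by norm_num
    rw [e5, e6] at hmain
    linarith [hmain, hsl, ht1, hsq]

/-- **Exponentiated form**: `|d_K| ≥ (4πe^{γ+0.838})^{r₁}(2πe^{γ+0.59})^{2r₂}·e^{−2√(π²n/2) − 60}`
for every number field `K` of degree `n`. [cite: Odlyzko1977, Theorem 1 (method; one-term instance)] -/
theorem absdiscr_ge_odlyzko_signature :
    (4 * Real.pi * Real.exp (Real.eulerMascheroniConstant + 0.838)) ^ nrRealPlaces K *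
        (2 * Real.pi * Real.exp (Real.eulerMascheroniConstant + 0.59)) ^ (2 * nrComplexPlaces K) *
        Real.exp (-(2 * Real.sqrt (Real.pi ^ 2 * Module.finrank ℚ K / 2) + 60)) ≤
      ((discr K).natAbs : ℝ) := by
  have h := log_absdiscr_ge_odlyzko_signature K
  have hπ0 := Real.pi_pos
  have hd : 0 < ((discr K).natAbs : ℝ) := by exact_mod_cast Int.natAbs_pos.mpr (discr_ne_zero K)
  have e4 : 4 * Real.pi * Real.exp (Real.eulerMascheroniConstant + 0.838) =
      Real.exp (Real.log (4 * Real.pi) + Real.eulerMascheroniConstant + 0.838) := by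
    simp only [Real.exp_add, Real.exp_log (show (0 : ℝ) < 4 * Real.pi by positivity)]
    ring
  have e2 : 2 * Real.pi * Real.exp (Real.eulerMascheroniConstant + 0.59) =
      Real.exp (Real.log (2 * Real.pi) + Real.eulerMascheroniConstant + 0.59) := by
    simp only [Real.exp_add, Real.exp_log (show (0 : ℝ) < 2 * Real.pi by positivity)]
    ring
  rw [e4, e2, ← Real.exp_nat_mul, ← Real.exp_nat_mul, ← Real.exp_add, ← Real.exp_add,
    ← Real.exp_log hd, Real.exp_le_exp]
  push_cast
  linarith


end OdlyzkoBound

end Summit.QuantumAdvantage.QuantumAdvantage.Theorems.DegreeOnePrimesEscape
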